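import Literature.MathematicalPhysics.QuantumFieldTheory.ConformalBootstrap3D.BlockExistenceAB
import Mathlib.Analysis.Calculus.Deriv.Shift
import HarnessLib

/-!
# The typed block's `z`-series solves the Casimir equation on the NEGATIVE square `(-1,0)²`

The typed 3D block `g^{Δ₁₂,Δ₃₄}_{Δ,ℓ}` (`IsConformalBlock3D`) is characterised on the open square `(0,1)²`,
but the function the tree constructs for it, `hrBlockAB Δ₁₂ Δ₃₄ Δ ℓ z z̄ = (z z̄)^{(Δ-ℓ)/2} Σ_{m,n} k_{mn} z^m z̄^n`
(`BlockExistenceAB`; Dolan–Osborn's double power series, absolutely convergent on the unit bidisk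
`|z|,|z̄| < 1`), is defined — and real-valued, `z z̄ > 0` — on the negative square `(-1,0)²` as well. This is
the continuation of the block needed by Dolan–Osborn's `1 ↔ 2` exchange relation (their 2011 eq. (2.23),
`x' = x/(x-1)` maps `(0,½)` onto `(-1,0)`; pub-ising3d AXIOMS-SOURCES §22, RECIPE R20 step (B'r)).
This file proves that the continuation solves the SAME quadratic Casimir equation there:

* `dolanOsbornR a b` — the reflected single-variable operator `x²(1+x)∂² + (a+b+1)x²∂ + ab x`, i.e.
  `D_z(a,b)` of Dolan–Osborn 2011 eq. (2.11) written in `x = -z` (`dolanOsbornD_slice_neg`,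
  `dolanOsbornD_slice_neg'`: `D_z[t ↦ G(-t,c)](z) = R_x[t ↦ G(t,c)](-z)`, unconditionally, by Mathlib's
  `deriv_comp_neg`), and `reflCasimirExpr3D` — the typed Casimir expression in reflected coordinates:
  `CasimirEq3D Δ₁₂ Δ₃₄ Δ ℓ (G∘neg) z z̄ ↔ reflCasimirExpr3D Δ₁₂ Δ₃₄ Δ ℓ G (-z) (-z̄) = 0`
  (`casimirEq3D_comp_neg_iff`).
* `reflCasimirExpr3D_eq_zero_of_satisfiesCoeffCasimir` — **the converse extraction theorem in reflected
  coordinates**: if `k` solves the five-term coefficient system `SatisfiesCoeffCasimir (-Δ₁₂/2) (Δ₃₄/2) Δ ℓ`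
  and `K = Σ k_{mn} z^m z̄^n` on the unit bidisk, then `G(x,x̄) = (x x̄)^α K(-x,-x̄)` satisfies
  `reflCasimirExpr3D … G = 0` on `(0,1)²`. Proof = the proof of
  `BlockExistence.casimirEq3D_of_satisfiesCoeffCasimir` run with the reflected array `k⁻_{mn} = (-1)^{m+n}k_{mn}`
  and the reflected operator: termwise the expression is `(x x̄)^α Σ_{P,Q} E⁻_{PQ} x^P x̄^Q` with
  `E⁻_{PQ}(k⁻) = (-1)^{P+Q} E_{PQ}(k)` (`reflCoeffLHS_sign`: the shift-one pieces `A, B` change sign, the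
  shift-two pieces `C, D, E` do not), hence zero.
* **`casimirEq3D_hrBlockAB_of_neg`** — for every `Δ` above the unitarity bound, every `(Δ₁₂, Δ₃₄)` and every
  `(z, z̄) ∈ (-1,0)²`: `CasimirEq3D Δ₁₂ Δ₃₄ Δ ℓ (hrBlockAB Δ₁₂ Δ₃₄ Δ ℓ) z z̄`; in particular for the
  `σ–ε` odd pair (`casimirEq3D_hrBlockAB_sigmaEps_of_neg`).

No new hypothesis-style fact; no statement about the square `(0,1)²` is changed. Together with
`BlockExchangeSymmetry.casimirEq3D_exchTransform_iff` (pub-ising3d lit-g15, DO11 (2.23) at the level of the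
operator) this gives: `v^{-Δ₃₄/2} · hrBlockAB (-Δ₁₂) Δ₃₄ Δ ℓ ∘ (z ↦ z/(z-1))` solves the `(Δ₁₂,Δ₃₄)` Casimir
equation on `(0,½)²` — step (B'r)+(cov) of RECIPE R20; the identification with `(-1)^ℓ hrBlockAB Δ₁₂ Δ₃₄ Δ ℓ`
(series form on the half-bidisk, extraction on `(0,½)²`, uniqueness) is NOT in this file.

References: F. A. Dolan, H. Osborn, arXiv:1108.6194, §2 eqs. (2.10)–(2.12), (2.23)
[cite: DolanOsborn2011, §2 eqs. (2.10)–(2.12)]; F. A. Dolan, H. Osborn, Nucl. Phys. B 678 (2004) 491, §3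
eqs. (3.9)–(3.12) (the `(a,b)` array) [cite: DolanOsborn2004, §3 eqs. (3.9)–(3.12)].
-/

namespace Literature.MathematicalPhysics.QuantumFieldTheory.ConformalBootstrap3D

open Set Filter Topology Finset

/-! ### The reflected operator and the negation chain rule -/

/-- The Dolan–Osborn operator in the reflected variable `x = -z`:
`R_x(a,b) f = x²(1+x) f'' + (a+b+1) x² f' + a b x f`. [cite: DolanOsborn2011, §2 eq. (2.11)] -/
noncomputable def dolanOsbornR (a b : ℝ) (f : ℝ → ℝ) (x : ℝ) : ℝ :=
  x ^ 2 * (1 + x) * deriv (deriv f) x + (a + b + 1) * x ^ 2 * deriv f x + a * b * x * f x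

/-- `dolanOsbornR` only sees the germ of `f` at `x`. [folklore] -/
theorem dolanOsbornR_congr_of_eventuallyEq {f₁ f₂ : ℝ → ℝ} {x : ℝ} (h : f₁ =ᶠ[𝓝 x] f₂)
    (a b : ℝ) : dolanOsbornR a b f₁ x = dolanOsbornR a b f₂ x := by
  have hd : deriv f₁ =ᶠ[𝓝 x] deriv f₂ := h.deriv
  unfold dolanOsbornR
  rw [h.deriv_eq, hd.deriv_eq, h.eq_of_nhds]

/-- First slice through a negation: `∂_t G(-t,c)|_z = -∂_x G(x,c)|_{-z}` (no differentiability needed).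
[folklore] -/
theorem deriv_slice_neg (G : ℝ → ℝ → ℝ) (c z : ℝ) :
    deriv (fun t => G (-t) c) z = -deriv (fun t => G t c) (-z) :=
  deriv_comp_neg (f := fun t => G t c) (x := z)

/-- Second slice through a negation. [folklore] -/
theorem deriv_slice_neg' (G : ℝ → ℝ → ℝ) (c z : ℝ) :
    deriv (fun t => G c (-t)) z = -deriv (fun t => G c t) (-z) :=
  deriv_comp_neg (f := fun t => G c t) (x := z)

/-- Second derivative of the first slice through a negation. [folklore] -/
theorem deriv_deriv_slice_neg (G : ℝ → ℝ → ℝ) (c z : ℝ) :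
    deriv (deriv (fun t => G (-t) c)) z = deriv (deriv (fun t => G t c)) (-z) := by
  have h1 : deriv (fun t => G (-t) c) = fun t => -deriv (fun t => G t c) (-t) :=
    funext fun t => deriv_slice_neg G c t
  rw [h1]
  have h2 : deriv (fun t => -deriv (fun t => G t c) (-t)) z
      = -deriv (fun t => deriv (fun t => G t c) (-t)) z :=
    deriv.fun_neg
  rw [h2, deriv_comp_neg (f := deriv (fun t => G t c)) (x := z), neg_neg]

/-- Second derivative of the second slice through a negation. [folklore] -/
theorem deriv_deriv_slice_neg' (G : ℝ → ℝ → ℝ) (c z : ℝ) :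
    deriv (deriv (fun t => G c (-t))) z = deriv (deriv (fun t => G c t)) (-z) := by
  have h1 : deriv (fun t => G c (-t)) = fun t => -deriv (fun t => G c t) (-t) :=
    funext fun t => deriv_slice_neg' G c t
  rw [h1]
  have h2 : deriv (fun t => -deriv (fun t => G c t) (-t)) z
      = -deriv (fun t => deriv (fun t => G c t) (-t)) z :=
    deriv.fun_neg
  rw [h2, deriv_comp_neg (f := deriv (fun t => G c t)) (x := z), neg_neg]

/-- `D_z(a,b)[t ↦ G(-t,c)](z) = R_x(a,b)[t ↦ G(t,c)](-z)`. [cite: DolanOsborn2011, §2 eq. (2.11)] -/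
theorem dolanOsbornD_slice_neg (a b : ℝ) (G : ℝ → ℝ → ℝ) (c z : ℝ) :
    dolanOsbornD a b (fun t => G (-t) c) z = dolanOsbornR a b (fun t => G t c) (-z) := by
  unfold dolanOsbornD dolanOsbornR
  rw [deriv_deriv_slice_neg, deriv_slice_neg]
  ring

/-- The same for the second slot. [cite: DolanOsborn2011, §2 eq. (2.11)] -/
theorem dolanOsbornD_slice_neg' (a b : ℝ) (G : ℝ → ℝ → ℝ) (c z : ℝ) :
    dolanOsbornD a b (fun t => G c (-t)) z = dolanOsbornR a b (fun t => G c t) (-z) := by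
  unfold dolanOsbornD dolanOsbornR
  rw [deriv_deriv_slice_neg', deriv_slice_neg']
  ring

/-- The typed Casimir expression in reflected coordinates `(x, x̄) = (-z, -z̄)`:
`(x̄ - x)[R_x G + R_x̄ G - c G] + x x̄[-(1+x)∂_x G + (1+x̄)∂_x̄ G]`.
[cite: DolanOsborn2011, §2 eqs. (2.10)–(2.12)] -/
noncomputable def reflCasimirExpr3D (Δ₁₂ Δ₃₄ Δ : ℝ) (ℓ : ℕ) (G : ℝ → ℝ → ℝ) (x xb : ℝ) : ℝ :=
  (xb - x) * (dolanOsbornR (-Δ₁₂ / 2) (Δ₃₄ / 2) (fun t => G t xb) x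
        + dolanOsbornR (-Δ₁₂ / 2) (Δ₃₄ / 2) (fun t => G x t) xb
        - casimirEigenvalue3D Δ ℓ * G x xb)
      + x * xb * (-(1 + x) * deriv (fun t => G t xb) x + (1 + xb) * deriv (fun t => G x t) xb)

/-- **Negation chain rule for the Casimir equation**: `G∘neg` solves the typed Casimir equation at `(z, z̄)`
iff the reflected expression of `G` vanishes at `(-z, -z̄)` (unconditional: `deriv` commutes with `t ↦ -t`).
[cite: DolanOsborn2011, §2 eqs. (2.10)–(2.12)] -/
theorem casimirEq3D_comp_neg_iff (Δ₁₂ Δ₃₄ Δ : ℝ) (ℓ : ℕ) (G : ℝ → ℝ → ℝ) (z zb : ℝ) :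
    CasimirEq3D Δ₁₂ Δ₃₄ Δ ℓ (fun s t => G (-s) (-t)) z zb ↔
      reflCasimirExpr3D Δ₁₂ Δ₃₄ Δ ℓ G (-z) (-zb) = 0 := by
  unfold CasimirEq3D reflCasimirExpr3D
  have e1 : (fun t => (fun s t => G (-s) (-t)) t zb) = fun t => G (-t) (-zb) := rfl
  have e2 : (fun t => (fun s t => G (-s) (-t)) z t) = fun t => G (-z) (-t) := rfl
  rw [e1, e2, dolanOsbornD_slice_neg, dolanOsbornD_slice_neg', deriv_slice_neg, deriv_slice_neg']
  constructor <;> intro h <;> linarith [h]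

/-! ### Generalised power series under the reflected operator -/

/-- `dolanOsbornR` of a generalised power series on `(0,1)`, termwise. [folklore] -/
theorem GeomSummable.dolanOsbornR_gps {ι : Type*} {c : ι → ℝ} {w : ι → ℕ} (h : GeomSummable c w)
    (a b β : ℝ) {x : ℝ} (hx : x ∈ Ioo (0 : ℝ) 1) :
    dolanOsbornR a b (gps c w β) x =
      x ^ 2 * (1 + x) * gps (fun i => c i * ((w i : ℝ) + β) * ((w i : ℝ) + (β - 1))) w (β - 1 - 1) x
        + (a + b + 1) * x ^ 2 * gps (fun i => c i * ((w i : ℝ) + β)) w (β - 1) x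
        + a * b * x * gps c w β x := by
  unfold dolanOsbornR
  rw [h.deriv_deriv_gps β hx, h.deriv_gps β hx]

/-! ### The reflected coefficient array -/

/-- The reflected array `k⁻_{mn} = (-1)^{m+n} k_{mn}` (coefficients of `K(-x,-x̄)`). [folklore] -/
def reflArr (k : ℕ × ℕ → ℝ) (p : ℕ × ℕ) : ℝ := (-1) ^ (p.1 + p.2) * k p

/-- `K(-x,-x̄)` is the double power series of the reflected array on the unit bidisk. [folklore] -/
theorem isDoublePowerSeriesOn_reflArr {k : ℕ × ℕ → ℝ} {K : ℝ → ℝ → ℝ} (hS : IsDoublePowerSeriesOn k K) :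
    IsDoublePowerSeriesOn (reflArr k) (fun x xb => K (-x) (-xb)) := by
  intro x xb hx hxb
  have hx' : |(-x)| < 1 := by rwa [abs_neg]
  have hxb' : |(-xb)| < 1 := by rwa [abs_neg]
  obtain ⟨_, hK⟩ := hS (-x) (-xb) hx' hxb'
  refine ⟨?_, ?_⟩
  · refine (hS x xb hx hxb).1.congr fun p => ?_
    rw [reflArr, abs_mul, abs_pow, abs_neg, abs_one, one_pow, one_mul]
  · change K (-x) (-xb) = _
    rw [hK]
    refine tsum_congr fun p => ?_
    rw [reflArr, neg_pow x, neg_pow xb, pow_add]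
    ring

/-- The reflected five-term combination: pieces of shift one (`A`, `B`) with the opposite sign, pieces of shift
two (`C`, `D`, `E`) unchanged (`R_x x^γ = γ(γ-1)x^γ + (γ+a)(γ+b)x^{γ+1}` versus
`D_z z^γ = γ(γ-1)z^γ - (γ+a)(γ+b)z^{γ+1}`). [cite: DolanOsborn2011, §2 eqs. (2.10)–(2.12)] -/
noncomputable def reflCoeffLHS (a b Δ : ℝ) (ℓ : ℕ) (k : ℕ × ℕ → ℝ) (P Q : ℕ) : ℝ :=
  (if 1 ≤ P then -(coeffA Δ ℓ (P - 1) Q * k (P - 1, Q)) else 0) +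
    (if 1 ≤ Q then -(coeffB Δ ℓ P (Q - 1) * k (P, Q - 1)) else 0) +
    (if 2 ≤ P then coeffC a b Δ ℓ (P - 2) * k (P - 2, Q) else 0) +
    (if 1 ≤ P ∧ 1 ≤ Q then coeffD a b Δ ℓ (P - 1) (Q - 1) * k (P - 1, Q - 1) else 0) +
    (if 2 ≤ Q then coeffE a b Δ ℓ (Q - 2) * k (P, Q - 2) else 0)

/-- **Sign rule**: on the reflected array the reflected combination is `(-1)^{P+Q}` times the original one.
[folklore] -/
theorem reflCoeffLHS_sign (a b Δ : ℝ) (ℓ : ℕ) (k : ℕ × ℕ → ℝ) (P Q : ℕ) :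
    reflCoeffLHS a b Δ ℓ (reflArr k) P Q = (-1) ^ (P + Q) * coeffCasimirLHS a b Δ ℓ k P Q := by
  unfold reflCoeffLHS coeffCasimirLHS reflArr
  have hA : (if 1 ≤ P then -(coeffA Δ ℓ (P - 1) Q * ((-1 : ℝ) ^ ((P - 1, Q).1 + (P - 1, Q).2) * k (P - 1, Q)))
      else 0) = (-1) ^ (P + Q) * (if 1 ≤ P then coeffA Δ ℓ (P - 1) Q * k (P - 1, Q) else 0) := by
    split_ifs with h
    · obtain ⟨P', rfl⟩ : ∃ P', P = P' + 1 := ⟨P - 1, by omega⟩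
      simp only [Nat.add_sub_cancel, pow_add, pow_one]
      ring
    · simp
  have hB : (if 1 ≤ Q then -(coeffB Δ ℓ P (Q - 1) * ((-1 : ℝ) ^ ((P, Q - 1).1 + (P, Q - 1).2) * k (P, Q - 1)))
      else 0) = (-1) ^ (P + Q) * (if 1 ≤ Q then coeffB Δ ℓ P (Q - 1) * k (P, Q - 1) else 0) := by
    split_ifs with h
    · obtain ⟨Q', rfl⟩ : ∃ Q', Q = Q' + 1 := ⟨Q - 1, by omega⟩
      simp only [Nat.add_sub_cancel, pow_add, pow_one]
      ring
    · simp
  have hC : (if 2 ≤ P then coeffC a b Δ ℓ (P - 2) * ((-1 : ℝ) ^ ((P - 2, Q).1 + (P - 2, Q).2) * k (P - 2, Q))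
      else 0) = (-1) ^ (P + Q) * (if 2 ≤ P then coeffC a b Δ ℓ (P - 2) * k (P - 2, Q) else 0) := by
    split_ifs with h
    · obtain ⟨P', rfl⟩ : ∃ P', P = P' + 2 := ⟨P - 2, by omega⟩
      simp only [Nat.add_sub_cancel, pow_add]
      ring
    · simp
  have hD : (if 1 ≤ P ∧ 1 ≤ Q then coeffD a b Δ ℓ (P - 1) (Q - 1) *
        ((-1 : ℝ) ^ ((P - 1, Q - 1).1 + (P - 1, Q - 1).2) * k (P - 1, Q - 1)) else 0)
      = (-1) ^ (P + Q) *
        (if 1 ≤ P ∧ 1 ≤ Q then coeffD a b Δ ℓ (P - 1) (Q - 1) * k (P - 1, Q - 1) else 0) := by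
    split_ifs with h
    · obtain ⟨P', rfl⟩ : ∃ P', P = P' + 1 := ⟨P - 1, by omega⟩
      obtain ⟨Q', rfl⟩ : ∃ Q', Q = Q' + 1 := ⟨Q - 1, by omega⟩
      simp only [Nat.add_sub_cancel, pow_add, pow_one]
      ring
    · simp
  have hE : (if 2 ≤ Q then coeffE a b Δ ℓ (Q - 2) * ((-1 : ℝ) ^ ((P, Q - 2).1 + (P, Q - 2).2) * k (P, Q - 2))
      else 0) = (-1) ^ (P + Q) * (if 2 ≤ Q then coeffE a b Δ ℓ (Q - 2) * k (P, Q - 2) else 0) := by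
    split_ifs with h
    · obtain ⟨Q', rfl⟩ : ∃ Q', Q = Q' + 2 := ⟨Q - 2, by omega⟩
      simp only [Nat.add_sub_cancel, pow_add]
      ring
    · simp
  rw [hA, hB, hC, hD, hE]
  ring

/-! ### The reflected converse extraction theorem -/

/-- **The coefficient system implies the Casimir equation on the negative square, in reflected coordinates.**
For `K = Σ k_{mn} z^m z̄^n` absolutely convergent on the unit bidisk with `SatisfiesCoeffCasimir (-Δ₁₂/2) (Δ₃₄/2) Δ ℓ k`
and `G(x,x̄) = (x x̄)^{(Δ-ℓ)/2} K(-x,-x̄)` on `(0,1)²`, the reflected Casimir expression of `G` vanishes on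
`(0,1)²`. [cite: DolanOsborn2011, §2 eqs. (2.9)–(2.12)] -/
theorem reflCasimirExpr3D_eq_zero_of_satisfiesCoeffCasimir {Δ₁₂ Δ₃₄ Δ : ℝ} {ℓ : ℕ} {G : ℝ → ℝ → ℝ}
    {k : ℕ × ℕ → ℝ} {K : ℝ → ℝ → ℝ} (hS : IsDoublePowerSeriesOn k K)
    (hG : ∀ x xb : ℝ, x ∈ Ioo (0 : ℝ) 1 → xb ∈ Ioo (0 : ℝ) 1 →
      G x xb = (x * xb) ^ ((Δ - (ℓ : ℝ)) / 2) * K (-x) (-xb))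
    (hk : SatisfiesCoeffCasimir (-Δ₁₂ / 2) (Δ₃₄ / 2) Δ ℓ k) :
    ∀ x xb : ℝ, x ∈ Ioo (0 : ℝ) 1 → xb ∈ Ioo (0 : ℝ) 1 → reflCasimirExpr3D Δ₁₂ Δ₃₄ Δ ℓ G x xb = 0 := by
  intro x xb hx hxb
  obtain ⟨hx0, hx1⟩ := hx
  obtain ⟨hxb0, hxb1⟩ := hxb
  have hR := isDoublePowerSeriesOn_reflArr hS
  set kr := reflArr k with hkr
  set Kr : ℝ → ℝ → ℝ := fun x xb => K (-x) (-xb) with hKr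
  have hG' : ∀ x xb : ℝ, x ∈ Ioo (0 : ℝ) 1 → xb ∈ Ioo (0 : ℝ) 1 →
      G x xb = (x * xb) ^ (halfTwist Δ ℓ) * Kr x xb := fun x xb hx hxb => by
    rw [hG x xb hx hxb]; rfl
  -- the two partial functions of `G` are generalised power series on `(0,1)`
  have G1 : GeomSummable (fun p : ℕ × ℕ => kr p * (xb ^ (halfTwist Δ ℓ) * xb ^ p.2)) Prod.fst :=
    hR.geomSummable_fst hxb0.le hxb1 _
  have G2 : GeomSummable (fun p : ℕ × ℕ => kr p * (x ^ (halfTwist Δ ℓ) * x ^ p.1)) Prod.snd :=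
    hR.geomSummable_snd hx0.le hx1 _
  have E1 : EqOn (fun t => G t xb)
      (gps (fun p : ℕ × ℕ => kr p * (xb ^ (halfTwist Δ ℓ) * xb ^ p.2)) Prod.fst (halfTwist Δ ℓ))
      (Ioo 0 1) := by
    intro t ht
    simp only [gps]
    rw [hG' t xb ht ⟨hxb0, hxb1⟩, hR.eq_tsum ht.1.le ht.2 hxb0.le hxb1, Real.mul_rpow ht.1.le hxb0.le,
      ← tsum_mul_left]
    refine tsum_congr fun p => ?_
    rw [Real.rpow_add ht.1, Real.rpow_natCast]; ring
  have E2 : EqOn (fun t => G x t)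
      (gps (fun p : ℕ × ℕ => kr p * (x ^ (halfTwist Δ ℓ) * x ^ p.1)) Prod.snd (halfTwist Δ ℓ))
      (Ioo 0 1) := by
    intro t ht
    simp only [gps]
    rw [hG' x t ⟨hx0, hx1⟩ ht, hR.eq_tsum hx0.le hx1 ht.1.le ht.2, Real.mul_rpow hx0.le ht.1.le,
      ← tsum_mul_left]
    refine tsum_congr fun p => ?_
    rw [Real.rpow_add ht.1, Real.rpow_natCast]; ring
  have e1 := Filter.eventuallyEq_of_mem (Ioo_mem_nhds hx0 hx1) E1
  have e2 := Filter.eventuallyEq_of_mem (Ioo_mem_nhds hxb0 hxb1) E2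
  have gx : G x xb = gps (fun p : ℕ × ℕ => kr p * (xb ^ (halfTwist Δ ℓ) * xb ^ p.2)) Prod.fst
      (halfTwist Δ ℓ) x := E1 ⟨hx0, hx1⟩
  -- the six `HasSum`s
  have hT1 := G1.hasSum_gps hx0 hx1 (halfTwist Δ ℓ)
  have hT1' := (G1.mul_weight (halfTwist Δ ℓ)).hasSum_gps hx0 hx1 (halfTwist Δ ℓ - 1)
  have hT1'' := ((G1.mul_weight (halfTwist Δ ℓ)).mul_weight (halfTwist Δ ℓ - 1)).hasSum_gps hx0 hx1
    (halfTwist Δ ℓ - 1 - 1)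
  have hT2 := G2.hasSum_gps hxb0 hxb1 (halfTwist Δ ℓ)
  have hT2' := (G2.mul_weight (halfTwist Δ ℓ)).hasSum_gps hxb0 hxb1 (halfTwist Δ ℓ - 1)
  have hT2'' := ((G2.mul_weight (halfTwist Δ ℓ)).mul_weight (halfTwist Δ ℓ - 1)).hasSum_gps hxb0
    hxb1 (halfTwist Δ ℓ - 1 - 1)
  have hL := ((((((hT1''.mul_left (x ^ 2 * (1 + x))).add
      (hT1'.mul_left (((-Δ₁₂ / 2) + Δ₃₄ / 2 + 1) * x ^ 2))).add
      (hT1.mul_left ((-Δ₁₂ / 2) * (Δ₃₄ / 2) * x))).add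
      (((hT2''.mul_left (xb ^ 2 * (1 + xb))).add
        (hT2'.mul_left (((-Δ₁₂ / 2) + Δ₃₄ / 2 + 1) * xb ^ 2))).add
        (hT2.mul_left ((-Δ₁₂ / 2) * (Δ₃₄ / 2) * xb)))).sub
      (hT1.mul_left (casimirEigenvalue3D Δ ℓ))).mul_left (xb - x)).add
    (((hT1'.mul_left (-(1 + x))).add (hT2'.mul_left (1 + xb))).mul_left (x * xb))
  -- the reflected Casimir expression, rewritten through the six generalised power series
  have hx : x ∈ Ioo (0 : ℝ) 1 := ⟨hx0, hx1⟩
  have hxb : xb ∈ Ioo (0 : ℝ) 1 := ⟨hxb0, hxb1⟩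
  unfold reflCasimirExpr3D
  rw [dolanOsbornR_congr_of_eventuallyEq e1, dolanOsbornR_congr_of_eventuallyEq e2, e1.deriv_eq,
    e2.deriv_eq, G1.dolanOsbornR_gps _ _ _ hx, G2.dolanOsbornR_gps _ _ _ hxb, G1.deriv_gps _ hx,
    G2.deriv_gps _ hxb, gx]
  -- termwise, the summand of `hL` is `(x x̄)^α kr_p Ψ⁻_p` with `Ψ⁻_p` the five weighted monomials
  have R1 : ∀ (m : ℕ) (β : ℝ), x ^ ((m : ℝ) + β) = x ^ β * x ^ m := fun m β => by
    rw [Real.rpow_add hx0, Real.rpow_natCast, mul_comm]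
  have R2 : ∀ (m : ℕ) (β : ℝ), xb ^ ((m : ℝ) + β) = xb ^ β * xb ^ m := fun m β => by
    rw [Real.rpow_add hxb0, Real.rpow_natCast, mul_comm]
  have hxne : x ≠ 0 := hx0.ne'
  have hxbne : xb ≠ 0 := hxb0.ne'
  have hFeq : (fun p : ℕ × ℕ =>
      (xb - x) *
          (x ^ 2 * (1 + x) *
                    (kr p * (xb ^ halfTwist Δ ℓ * xb ^ p.2) * (↑p.1 + halfTwist Δ ℓ) *
                      (↑p.1 + (halfTwist Δ ℓ - 1)) * x ^ (↑p.1 + (halfTwist Δ ℓ - 1 - 1))) +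
                  (-Δ₁₂ / 2 + Δ₃₄ / 2 + 1) * x ^ 2 *
                    (kr p * (xb ^ halfTwist Δ ℓ * xb ^ p.2) * (↑p.1 + halfTwist Δ ℓ) *
                      x ^ (↑p.1 + (halfTwist Δ ℓ - 1))) +
                -Δ₁₂ / 2 * (Δ₃₄ / 2) * x *
                  (kr p * (xb ^ halfTwist Δ ℓ * xb ^ p.2) * x ^ (↑p.1 + halfTwist Δ ℓ)) +
              (xb ^ 2 * (1 + xb) *
                    (kr p * (x ^ halfTwist Δ ℓ * x ^ p.1) * (↑p.2 + halfTwist Δ ℓ) *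
                      (↑p.2 + (halfTwist Δ ℓ - 1)) * xb ^ (↑p.2 + (halfTwist Δ ℓ - 1 - 1))) +
                  (-Δ₁₂ / 2 + Δ₃₄ / 2 + 1) * xb ^ 2 *
                    (kr p * (x ^ halfTwist Δ ℓ * x ^ p.1) * (↑p.2 + halfTwist Δ ℓ) *
                      xb ^ (↑p.2 + (halfTwist Δ ℓ - 1))) +
                -Δ₁₂ / 2 * (Δ₃₄ / 2) * xb *
                  (kr p * (x ^ halfTwist Δ ℓ * x ^ p.1) * xb ^ (↑p.2 + halfTwist Δ ℓ))) -
            casimirEigenvalue3D Δ ℓ * (kr p * (xb ^ halfTwist Δ ℓ * xb ^ p.2) * x ^ (↑p.1 + halfTwist Δ ℓ))) +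
        x * xb *
          (-(1 + x) *
              (kr p * (xb ^ halfTwist Δ ℓ * xb ^ p.2) * (↑p.1 + halfTwist Δ ℓ) *
                x ^ (↑p.1 + (halfTwist Δ ℓ - 1))) +
            (1 + xb) *
              (kr p * (x ^ halfTwist Δ ℓ * x ^ p.1) * (↑p.2 + halfTwist Δ ℓ) *
                xb ^ (↑p.2 + (halfTwist Δ ℓ - 1))))) =
      fun p : ℕ × ℕ => (x * xb) ^ (halfTwist Δ ℓ) *
        (-(coeffA Δ ℓ p.1 p.2 * kr p * x ^ (p.1 + 1) * xb ^ p.2)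
          + -(coeffB Δ ℓ p.1 p.2 * kr p * x ^ p.1 * xb ^ (p.2 + 1))
          + coeffC (-Δ₁₂ / 2) (Δ₃₄ / 2) Δ ℓ p.1 * kr p * x ^ (p.1 + 2) * xb ^ p.2
          + coeffD (-Δ₁₂ / 2) (Δ₃₄ / 2) Δ ℓ p.1 p.2 * kr p * x ^ (p.1 + 1) * xb ^ (p.2 + 1)
          + coeffE (-Δ₁₂ / 2) (Δ₃₄ / 2) Δ ℓ p.2 * kr p * x ^ p.1 * xb ^ (p.2 + 2)) := by
    funext p
    simp only [R1, R2, Real.rpow_sub_one hxne, Real.rpow_sub_one hxbne,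
      Real.mul_rpow hx0.le hxb0.le, coeffA, coeffB, coeffC, coeffD, coeffE]
    field_simp
    ring
  rw [hFeq] at hL
  -- the five pieces and their pushforwards to the monomial `x^P x̄^Q`
  have sA := hR.summable_pieceA hx0.le hx1 hxb0.le hxb1 Δ ℓ
  have sB := hR.summable_pieceB hx0.le hx1 hxb0.le hxb1 Δ ℓ
  have sC := hR.summable_pieceC hx0.le hx1 hxb0.le hxb1 (-Δ₁₂ / 2) (Δ₃₄ / 2) Δ ℓ
  have sD := hR.summable_pieceD hx0.le hx1 hxb0.le hxb1 (-Δ₁₂ / 2) (Δ₃₄ / 2) Δ ℓ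
  have sE := hR.summable_pieceE hx0.le hx1 hxb0.le hxb1 (-Δ₁₂ / 2) (Δ₃₄ / 2) Δ ℓ
  have hP5 := (((sA.hasSum.neg.add sB.hasSum.neg).add sC.hasSum).add sD.hasSum).add sE.hasSum
  have hP := hP5.mul_left ((x * xb) ^ (halfTwist Δ ℓ))
  have hfin := hL.unique hP
  have hA := hasSum_shift10
    (G := fun q : ℕ × ℕ => -(coeffA Δ ℓ (q.1 - 1) q.2 * kr (q.1 - 1, q.2) * x ^ q.1 * xb ^ q.2))
    (by simpa using sA.hasSum.neg)
  have hB := hasSum_shift01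
    (G := fun q : ℕ × ℕ => -(coeffB Δ ℓ q.1 (q.2 - 1) * kr (q.1, q.2 - 1) * x ^ q.1 * xb ^ q.2))
    (by simpa using sB.hasSum.neg)
  have hC' := hasSum_shift20
    (G := fun q : ℕ × ℕ =>
      coeffC (-Δ₁₂ / 2) (Δ₃₄ / 2) Δ ℓ (q.1 - 2) * kr (q.1 - 2, q.2) * x ^ q.1 * xb ^ q.2)
    (by simpa using sC.hasSum)
  have hD := hasSum_shift11
    (G := fun q : ℕ × ℕ =>
      coeffD (-Δ₁₂ / 2) (Δ₃₄ / 2) Δ ℓ (q.1 - 1) (q.2 - 1) * kr (q.1 - 1, q.2 - 1) * x ^ q.1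
        * xb ^ q.2)
    (by simpa using sD.hasSum)
  have hE := hasSum_shift02
    (G := fun q : ℕ × ℕ =>
      coeffE (-Δ₁₂ / 2) (Δ₃₄ / 2) Δ ℓ (q.2 - 2) * kr (q.1, q.2 - 2) * x ^ q.1 * xb ^ q.2)
    (by simpa using sE.hasSum)
  have hq := (((hA.add hB).add hC').add hD).add hE
  have hqL : HasSum (fun q : ℕ × ℕ =>
      reflCoeffLHS (-Δ₁₂ / 2) (Δ₃₄ / 2) Δ ℓ kr q.1 q.2 * x ^ q.1 * xb ^ q.2)
      (-(∑' p : ℕ × ℕ, coeffA Δ ℓ p.1 p.2 * kr p * x ^ (p.1 + 1) * xb ^ p.2)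
        + -(∑' p : ℕ × ℕ, coeffB Δ ℓ p.1 p.2 * kr p * x ^ p.1 * xb ^ (p.2 + 1))
        + (∑' p : ℕ × ℕ, coeffC (-Δ₁₂ / 2) (Δ₃₄ / 2) Δ ℓ p.1 * kr p * x ^ (p.1 + 2) * xb ^ p.2)
        + (∑' p : ℕ × ℕ,
            coeffD (-Δ₁₂ / 2) (Δ₃₄ / 2) Δ ℓ p.1 p.2 * kr p * x ^ (p.1 + 1) * xb ^ (p.2 + 1))
        + (∑' p : ℕ × ℕ,
            coeffE (-Δ₁₂ / 2) (Δ₃₄ / 2) Δ ℓ p.2 * kr p * x ^ p.1 * xb ^ (p.2 + 2))) := by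
    convert hq using 1
    funext q
    simp only [reflCoeffLHS, add_mul, ite_mul, zero_mul, neg_mul]
  have hzero : (fun q : ℕ × ℕ =>
      reflCoeffLHS (-Δ₁₂ / 2) (Δ₃₄ / 2) Δ ℓ kr q.1 q.2 * x ^ q.1 * xb ^ q.2) = fun _ => 0 := by
    funext q
    rw [hkr, reflCoeffLHS_sign, hk q.1 q.2, mul_zero, zero_mul, zero_mul]
  rw [hzero] at hqL
  have hS5 := hqL.unique hasSum_zero
  rw [hS5, mul_zero] at hfin
  linear_combination hfin

/-! ### The typed block on the negative square -/

/-- **The `z`-series block solves the Casimir equation on the negative square.** For `Δ` strictly above the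
3D unitarity bound, every `(Δ₁₂, Δ₃₄)` and every `(z, z̄) ∈ (-1,0)²`, the function `hrBlockAB Δ₁₂ Δ₃₄ Δ ℓ`
(`= (z z̄)^{(Δ-ℓ)/2} Σ k^{ab}_{mn} z^m z̄^n`, the continuation of the typed block through its own `z`-series)
satisfies `CasimirEq3D Δ₁₂ Δ₃₄ Δ ℓ` at `(z, z̄)`. [cite: DolanOsborn2011, §2 eqs. (2.9)–(2.12)] -/
theorem casimirEq3D_hrBlockAB_of_neg {Δ₁₂ Δ₃₄ Δ : ℝ} {ℓ : ℕ} (hΔ : unitarityBound3D ℓ < Δ)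
    {z zb : ℝ} (hz : z ∈ Ioo (-1 : ℝ) 0) (hzb : zb ∈ Ioo (-1 : ℝ) 0) :
    CasimirEq3D Δ₁₂ Δ₃₄ Δ ℓ (hrBlockAB Δ₁₂ Δ₃₄ Δ ℓ) z zb := by
  set G : ℝ → ℝ → ℝ := fun x xb => hrBlockAB Δ₁₂ Δ₃₄ Δ ℓ (-x) (-xb) with hGdef
  have hfun : hrBlockAB Δ₁₂ Δ₃₄ Δ ℓ = fun s t => G (-s) (-t) := by
    funext s t; simp [hGdef]
  rw [hfun, casimirEq3D_comp_neg_iff]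
  have hx : -z ∈ Ioo (0 : ℝ) 1 := ⟨by linarith [hz.2], by linarith [hz.1]⟩
  have hxb : -zb ∈ Ioo (0 : ℝ) 1 := ⟨by linarith [hzb.2], by linarith [hzb.1]⟩
  refine reflCasimirExpr3D_eq_zero_of_satisfiesCoeffCasimir (isDoublePowerSeriesOn_hrSeriesAB hΔ)
    (fun x xb _ _ => ?_) (hrMonomialCoeffAB_satisfies _ _ hΔ) (-z) (-zb) hx hxb
  simp only [hGdef, hrBlockAB, neg_mul_neg]

/-- The `σ–ε` odd pair: for `s = Δ_σ - Δ_ε` both `hrBlockAB s s Δ ℓ` (`⟨σεσε⟩`) and `hrBlockAB (-s) s Δ ℓ`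
(`⟨εσσε⟩`) solve their Casimir equations on `(-1,0)²` — the continuation step used by RECIPE R20 of
pub-ising3d (with `BlockExchangeSymmetry.casimirEq3D_sigmaEps_exch_iff`).
[cite: DolanOsborn2011, §2 eq. (2.23)] -/
theorem casimirEq3D_hrBlockAB_sigmaEps_of_neg (Δσ Δε : ℝ) {Δ : ℝ} {ℓ : ℕ} (hΔ : unitarityBound3D ℓ < Δ)
    {z zb : ℝ} (hz : z ∈ Ioo (-1 : ℝ) 0) (hzb : zb ∈ Ioo (-1 : ℝ) 0) :
    CasimirEq3D (Δσ - Δε) (Δσ - Δε) Δ ℓ (hrBlockAB (Δσ - Δε) (Δσ - Δε) Δ ℓ) z zb ∧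
      CasimirEq3D (-(Δσ - Δε)) (Δσ - Δε) Δ ℓ (hrBlockAB (-(Δσ - Δε)) (Δσ - Δε) Δ ℓ) z zb :=
  ⟨casimirEq3D_hrBlockAB_of_neg hΔ hz hzb, casimirEq3D_hrBlockAB_of_neg hΔ hz hzb⟩

end Literature.MathematicalPhysics.QuantumFieldTheory.ConformalBootstrap3D
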